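import Mathlib
import Summits.Ventures.HodgeRepro.Tier4.Line1.SpectralOfRTF

/-!
# Tier4/Line1/SpectralOfRTFIsolated — the seesaw residual of LINE L1 with the finite-spectrum DATA eliminated:
isolation is the RTF's OWN vanishing of the other blocks

Blind re-derivation cell `pub-hodge-repro`, Tier 4 (README §9–§10), seat t4-L1-p1 (gen 3).  Target tree path
`lean/Summits/Ventures/HodgeRepro/Tier4/Line1/SpectralOfRTFIsolated.lean`.  Imports this seat's `SpectralOfRTF`
(p679406: `specTerm`, `specBlock`, `hasSum_specBlock`, `atoms_of_specBlock_ne_zero`, `spectralOfRTF`,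
`SpectralIdentification`, `IsolationNonvanishing`, `P_of_rtf_identification`).

WHAT THIS IS.  `SpectralOfRTF` displays the seesaw half of L1's residual as (S1′) `SpectralIdentification` and (S3′)
`IsolationNonvanishing` over a DISPLAYED finite spectrum `spec : W.Translates → Finset ℕ`.  That datum is not needed:
the RTF itself says when a test pair isolates `τ m` — every other block of its spectral expansion vanishes and the
`m`-block does not (`IsolatedAt`, DEFINED on every `RTF.Setting`) — and then `J(f₁ ⋆ f₂)` IS the `m`-block
(`J_eq_specBlock_of_isolatedAt`, from `hasSum_specBlock` and `hasSum_single`).  The residual becomes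
* (S1″) `SpectralIdentificationAt`: at a Hecke choice `γ` whose test pair isolates `τ m`, the concrete Hodge pairing
  `W.hodgePairing γ` is the `m`-block — equivalently (`spectralIdentificationAt_iff_J`) it is the RTF distribution
  `J` at that test pair: the one-line seesaw identity «Hodge pairing = RTF distribution at the matching test pair»,
  asked only where the assembly uses it (WEAKER than (S1′): nothing is asked of non-isolating choices);
* (S3″) `IsolationRealised`: an invariant subspace `τ m` carrying both toric functionals and the lift clause is
  isolated by the test pair of some Hecke choice (Hecke isolation on the RTF side + the Rallis non-vanishing of the
  block).
`P_of_rtf_isolated` / `conclusion_of_rtf_isolated` run L1's assembly on (S1″) + (S3″); `IsolatedAt.unique` says the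
isolated index is unique; `isolationNonvanishing_of_isolationRealised` recovers (S3′) for the spectrum `{m}` read off
the isolation.  Honesty: (S1″) does NOT yield (S1) of night-2's interface for every choice (no statement is made at
non-isolating choices), so the by-name plug `exists_seesaw_of_identification` of `SpectralOfRTF` keeps (S1′); this
file feeds the DIRECT assembly only.  The isolating pair `(f₁, f₂)` of J2 is NOT a test pair of a Hecke choice —
a hypothesis `∃ γ₀, tf γ₀ = (f₁, f₂)` would give (P) in one line and is false on the intended instance (bumps are
not Hecke test pairs); that is why the spectral side stands between J2 and (P), here as in `SpectralOfRTF`.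
Nothing of the seesaw is proved here: (S1″) and (S3″) are hypotheses wherever they are used.  Nothing here says
anything about the status of the Hodge conjecture for CM abelian varieties, which is NOT proved (HC_CM is NOT proved
by anyone in this repository).
-/

set_option autoImplicit false

noncomputable section

namespace Summit.Ventures.HodgeRepro.Tier4.Line1

open NumberField Common PeriodCloser MeasureTheory RTF

namespace RTF

namespace Setting

section Isolated

variable {G : Type} [Group G] [TopologicalSpace G] [IsTopologicalGroup G] [MeasurableSpace G] [BorelSpace G]
  (S : Setting G) (χ : S.T → ℂ) (χ' : S.T' → ℂ) (φ : ℕ → G → ℂ) (n : ℕ → ℕ) (f₁ f₂ : G → ℂ)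

/-- **the test pair `(f₁, f₂)` isolates `τ m`**: every block of the spectral expansion of `J(f₁ ⋆ f₂)` other than
the `m`-block vanishes, and the `m`-block does not. -/
def IsolatedAt (m : ℕ) : Prop :=
  (∀ m', m' ≠ m → specBlock S χ χ' φ n f₁ f₂ m' = 0) ∧ specBlock S χ χ' φ n f₁ f₂ m ≠ 0

omit [IsTopologicalGroup G] [BorelSpace G] in
/-- the isolated index is unique. -/
theorem IsolatedAt.unique {m m' : ℕ} (h : IsolatedAt S χ χ' φ n f₁ f₂ m) (h' : IsolatedAt S χ χ' φ n f₁ f₂ m') :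
    m = m' := by
  by_contra hne
  exact h.2 (h'.1 m hne)

/-- **`J(f₁ ⋆ f₂)` is the isolated block**: on an isolating test pair the spectral expansion has one non-zero block. -/
theorem J_eq_specBlock_of_isolatedAt (hχ : S.IsCharacter χ) (hχ' : S.IsCharacter' χ') {τ : ℕ → Set (G → ℂ)}
    (hB : S.IsAdaptedONB τ φ n) (h₁ : IsTest f₁) (h₂ : IsTest f₂) {m : ℕ}
    (h : IsolatedAt S χ χ' φ n f₁ f₂ m) :
    S.J χ χ' (S.conv f₁ f₂) = specBlock S χ χ' φ n f₁ f₂ m := by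
  have hs := S.hasSum_specBlock χ χ' φ n f₁ f₂ hχ hχ' hB h₁ h₂
  have hsingle : HasSum (specBlock S χ χ' φ n f₁ f₂) (specBlock S χ χ' φ n f₁ f₂ m) :=
    hasSum_single m fun m' hm' => h.1 m' hm'
  exact hs.unique hsingle

/-- on an isolating test pair the RTF distribution is non-zero. -/
theorem J_ne_zero_of_isolatedAt (hχ : S.IsCharacter χ) (hχ' : S.IsCharacter' χ') {τ : ℕ → Set (G → ℂ)}
    (hB : S.IsAdaptedONB τ φ n) (h₁ : IsTest f₁) (h₂ : IsTest f₂) {m : ℕ}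
    (h : IsolatedAt S χ χ' φ n f₁ f₂ m) : S.J χ χ' (S.conv f₁ f₂) ≠ 0 := by
  rw [S.J_eq_specBlock_of_isolatedAt χ χ' φ n f₁ f₂ hχ hχ' hB h₁ h₂ h]
  exact h.2

omit [BorelSpace G] in
/-- an isolating test pair exhibits both toric functionals on `τ m` and a vector of `τ m` hit by `f̄₁`. -/
theorem atoms_of_isolatedAt {τ : ℕ → Set (G → ℂ)} (hB : S.IsAdaptedONB τ φ n) (h₁ : IsTest f₁) (h₂ : IsTest f₂)
    {m : ℕ} (h : IsolatedAt S χ χ' φ n f₁ f₂ m) :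
    S.PeriodNonzeroT χ (τ m) ∧ S.PeriodNonzeroT' χ' (τ m) ∧ S.Hit (cj f₁) (τ m) :=
  S.atoms_of_specBlock_ne_zero χ χ' φ n f₁ f₂ hB h₁ h₂ h.2

end Isolated

end Setting

end RTF

section Interface

variable {Form : Type} [AddCommGroup Form] [Module ℂ Form] {A : FormAlgebra Form} {W : Witness A}
  {G : Type} [Group G] [TopologicalSpace G] [IsTopologicalGroup G] [MeasurableSpace G] [BorelSpace G]
  (S : RTF.Setting G) (χ : S.T → ℂ) (χ' : S.T' → ℂ) (τ : ℕ → Set (G → ℂ)) (Lift : ℕ → Prop)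
  (φ : ℕ → G → ℂ) (n : ℕ → ℕ) (tf : W.Translates → (G → ℂ) × (G → ℂ))

/-- **(S1″) — THE IDENTIFICATION AT ISOLATING CHOICES, DISPLAYED**: at a Hecke choice `γ` whose test pair isolates
`τ m`, the concrete Hodge pairing of `γ` is the `m`-block of the RTF at that test pair (equivalently the RTF
distribution `J` there, `spectralIdentificationAt_iff_J`).  Weaker than `SpectralIdentification`: nothing is asked
of non-isolating choices and no finite spectrum is displayed.  A HYPOTHESIS wherever it is used; proved nowhere. -/
def SpectralIdentificationAt : Prop :=
  ∀ (γ : W.Translates) (m : ℕ), S.IsolatedAt χ χ' φ n (tf γ).1 (tf γ).2 m →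
    W.hodgePairing γ = S.specBlock χ χ' φ n (tf γ).1 (tf γ).2 m

/-- **(S3″) — ISOLATION REALISED BY A HECKE CHOICE, DISPLAYED**: an invariant subspace `τ m` carrying both toric
functionals and the lift clause is isolated (other blocks zero, `m`-block non-zero) by the test pair of some Hecke
choice — Hecke isolation on the RTF side + the Rallis non-vanishing of the block.  A HYPOTHESIS wherever it is used;
proved nowhere. -/
def IsolationRealised : Prop :=
  ∀ m : ℕ, S.PeriodNonzeroT χ (τ m) → S.PeriodNonzeroT' χ' (τ m) → Lift m →
    ∃ γ' : W.Translates, S.IsolatedAt χ χ' φ n (tf γ').1 (tf γ').2 m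

/-- (S1″) in its one-line form: at an isolating Hecke choice the Hodge pairing IS the RTF distribution at the test
pair of the choice. -/
theorem spectralIdentificationAt_iff_J (hχ : S.IsCharacter χ) (hχ' : S.IsCharacter' χ') (hB : S.IsAdaptedONB τ φ n)
    (h₁ : ∀ γ, IsTest (tf γ).1) (h₂ : ∀ γ, IsTest (tf γ).2) :
    SpectralIdentificationAt S χ χ' φ n tf ↔
      ∀ (γ : W.Translates) (m : ℕ), S.IsolatedAt χ χ' φ n (tf γ).1 (tf γ).2 m →
        W.hodgePairing γ = S.J χ χ' (S.conv (tf γ).1 (tf γ).2) := by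
  constructor
  · intro h γ m hm
    rw [S.J_eq_specBlock_of_isolatedAt χ χ' φ n (tf γ).1 (tf γ).2 hχ hχ' hB (h₁ γ) (h₂ γ) hm]
    exact h γ m hm
  · intro h γ m hm
    rw [← S.J_eq_specBlock_of_isolatedAt χ χ' φ n (tf γ).1 (tf γ).2 hχ hχ' hB (h₁ γ) (h₂ γ) hm]
    exact h γ m hm

omit [IsTopologicalGroup G] [BorelSpace G] in
/-- (S3′) of `SpectralOfRTF` from (S3″), for the spectrum that reads `{m}` off the isolation (any choice of the
finite spectrum agreeing with the isolation works; this one is `{m}` at isolating choices, `∅` elsewhere). -/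
theorem isolationNonvanishing_of_isolationRealised (h : IsolationRealised S χ χ' τ Lift φ n tf) :
    IsolationNonvanishing S χ χ' τ Lift φ n tf fun γ => by
      classical
      exact if hγ : ∃ m, S.IsolatedAt χ χ' φ n (tf γ).1 (tf γ).2 m then {hγ.choose} else ∅ := by
  intro m hT hT' hl
  obtain ⟨γ', hγ'⟩ := h m hT hT' hl
  refine ⟨γ', ?_, hγ'.2⟩
  have hex : ∃ m, S.IsolatedAt χ χ' φ n (tf γ').1 (tf γ').2 m := ⟨m, hγ'⟩
  simp only [hex, dite_true]
  rw [Finset.singleton_inj]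
  exact RTF.Setting.IsolatedAt.unique S χ χ' φ n (tf γ').1 (tf γ').2 hex.choose_spec hγ'

/-- **(P) for the witness from the RTF inputs and (S1″) + (S3″)**: the DEFINED content produces `m` with both toric
functionals on `τ m` hit by `f̄₁`; the lift hypothesis gives `Lift m`; (S3″) a Hecke choice `γ'` isolating `τ m`;
(S1″) at `γ'` makes the Hodge pairing of `γ'` the non-zero `m`-block. -/
theorem P_of_rtf_isolated (hχ : S.IsCharacter χ) (hχ' : S.IsCharacter' χ') (hB : S.IsAdaptedONB τ φ n)
    {f₁ f₂ : G → ℂ} (h₁ : IsTest f₁) (h₂ : IsTest f₂) (hconv : IsTest (S.conv f₁ f₂)) {o₀ : S.Orbit}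
    (hiso : S.geoSupport (S.conv f₁ f₂) = {o₀}) (hne : S.orbital χ χ' o₀ (S.conv f₁ f₂) ≠ 0)
    (hlift : ∀ m, S.PeriodNonzeroT χ (τ m) → S.PeriodNonzeroT' χ' (τ m) → S.Hit (cj f₁) (τ m) → Lift m)
    (hS1 : SpectralIdentificationAt S χ χ' φ n tf) (hS3 : IsolationRealised S χ χ' τ Lift φ n tf) : W.P := by
  obtain ⟨m, hT, hT', hhit⟩ := S.exists_periods_of_isolation hχ hχ' hB h₁ h₂ hconv hiso hne
  obtain ⟨γ', hγ'⟩ := hS3 m hT hT' (hlift m hT hT' hhit)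
  refine ⟨γ', ?_⟩
  rw [hS1 γ' m hγ']
  exact hγ'.2

end Interface

section Target

variable {F E : Type} [Field F] [NumberField F] [IsGalois ℚ F] [IsCMField F]
  [Field E] [NumberField E] [IsGalois ℚ E] [IsCMField E]

/-- **The conclusion of `P_T4` for a datum `d` from the RTF inputs and (S1″) + (S3″)** — `conclusion_of_rtf_identification`
with the finite-spectrum datum `spec` gone and the two identities in their isolated form; the binders `Γ'`, `hΓ'`,
`hcc`, the RTF data and its DEFINED content, `Lift`, `hlift`, `tf` are as before. -/
theorem conclusion_of_rtf_isolated (d : TargetData F E) {Γ' : Set (Matrix (Fin 3) (Fin 3) E)}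
    (hΓ' : d.IsLevel Γ') (hcc : d.IsCocompact Γ')
    {G : Type} [Group G] [TopologicalSpace G] [IsTopologicalGroup G] [MeasurableSpace G] [BorelSpace G]
    (S : RTF.Setting G) {χ : S.T → ℂ} {χ' : S.T' → ℂ} (hχ : S.IsCharacter χ) (hχ' : S.IsCharacter' χ')
    {τ : ℕ → Set (G → ℂ)} {φ : ℕ → G → ℂ} {n : ℕ → ℕ} (hB : S.IsAdaptedONB τ φ n) {f₁ f₂ : G → ℂ}
    (h₁ : RTF.IsTest f₁) (h₂ : RTF.IsTest f₂) (hconv : RTF.IsTest (S.conv f₁ f₂)) {o₀ : S.Orbit}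
    (hiso : S.geoSupport (S.conv f₁ f₂) = {o₀}) (hne : S.orbital χ χ' o₀ (S.conv f₁ f₂) ≠ 0)
    (Lift : ℕ → Prop)
    (hlift : ∀ m, S.PeriodNonzeroT χ (τ m) → S.PeriodNonzeroT' χ' (τ m) → S.Hit (RTF.cj f₁) (τ m) → Lift m)
    (tf : (d.concreteWitness hΓ' (isDomain_dom d hΓ').subset_ball (isDomain_dom d hΓ').measurableSet
      (d.residual_of_cocompact hΓ' hcc)).Translates → (G → ℂ) × (G → ℂ))
    (hS1 : SpectralIdentificationAt S χ χ' φ n tf) (hS3 : IsolationRealised S χ χ' τ Lift φ n tf) :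
    d.conclusion :=
  d.conclusion_of_concrete_P_cocompact hΓ' hcc
    (P_of_rtf_isolated (A := d.holoFormAlgebra Γ' (isDomain_dom d hΓ').subset_ball
      (isDomain_dom d hΓ').measurableSet (d.residual_of_cocompact hΓ' hcc).pos (d.residual_of_cocompact hΓ' hcc).fin)
      (W := d.concreteWitness hΓ' (isDomain_dom d hΓ').subset_ball (isDomain_dom d hΓ').measurableSet
        (d.residual_of_cocompact hΓ' hcc))
      S χ χ' τ Lift φ n tf hχ hχ' hB h₁ h₂ hconv hiso hne hlift hS1 hS3)

end Target

end Summit.Ventures.HodgeRepro.Tier4.Line1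

end
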